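import Mathlib
import HarnessLib
import Literature.Probability.LatticeModels.IsingLimitLaw
import Literature.Probability.LatticeModels.IsingLimitLawTilt
import Literature.Probability.LatticeModels.IsingLimitLawLaplace
import Literature.Analysis.Complex.PolyaBesselKernel
import Summits.RiemannHypothesis.RiemannHypothesis.Theorems.LeeYangLeeyangPolyaKernelIsingLimitDefs

/-!
# Transfer-matrix identity for open Ising chains: stub `stub_transfer` of the line
`telegraph-bessel-chain` (crux stmt-RiemannHypothesis-0453)

For the open chain on the sites `0, …, N` (`Fin (N + 1)`) whose bond `m` couples the sites
`m, m + 1` with coupling `K m` (coupling matrix `chainJ (N + 1) K`) and with weights `w m`, the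
Laplace transform of the magnetization law is
`∫ e^{zu} d(law)(u) = (sdIter z w (tanh ∘ K) N).1 / 2`, where
`X₀ = (2 cosh (z w₀), 2 sinh (z w₀))`, `X_{m+1} = sdStep (z w_{m+1}) (tanh K_m) X_m`.

Proof (the transfer matrix of the chain, written in the basis `(S, D)` = (sum, last-spin-weighted
sum)). Put `T_s = B_s e^{z M_s}` (Boltzmann weight times field factor of a configuration `s` of the
chain on `Fin (N + 1)`), `Z_N = Σ_s T_s` and `Z'_N = Σ_s T_s σ_N(s)`. Splitting a configuration of
the chain on `Fin (N + 2)` into its restriction and its last spin `b` (`Fin.snoc`), the energy and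
the magnetization split as `E + K_N σ_N b`, `M + w_{N+1} b`, and
`e^{K σ b} = cosh K · (1 + tanh K · σ b)` for `σ, b = ±1`; summing over `b = ±1` gives
`(Z, Z')_{N+1} = 2 cosh K_N · sdStep (z w_{N+1}) (tanh K_N) (Z, Z')_N`, whence
`(Z_N, Z'_N) = (∏_{m<N} 2 cosh K_m) · X_N` (`chain_partition_pair`). At `z = 0`, `X_N = (2, 0)`,
and `∫ e^{zu} d(law) = Z_N(z) / Z_N(0)` is the tree lemma `integral_exp_isingMagnetizationLaw`.
References: folklore (E. Ising, Z. Phys. 31 (1925) 253; Kramers–Wannier, Phys. Rev. 60 (1941) 252,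
the transfer matrix).
-/

noncomputable section

namespace Summit.RiemannHypothesis.RiemannHypothesis.Theorems.LeeYangTelegraph

open MeasureTheory Filter Topology Complex
open Literature.Probability.LatticeModels Literature.Analysis.Complex.Polya1926

/-! ### Splitting off the last spin -/

/-- Sums over the configurations `Fin (n + 1) → Bool` split off the last coordinate. [folklore] -/
private theorem sum_config_snoc {M : Type*} [AddCommMonoid M] (n : ℕ)
    (g : (Fin (n + 1) → Bool) → M) :
    ∑ s, g s = ∑ s : Fin n → Bool,
      (g (Fin.snoc s true : Fin (n + 1) → Bool) + g (Fin.snoc s false : Fin (n + 1) → Bool)) := by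
  rw [← (Fin.snocEquiv fun _ : Fin (n + 1) => Bool).sum_comp, Fintype.sum_prod_type,
    Fintype.sum_bool, ← Finset.sum_add_distrib]
  rfl

/-- The spins of `snoc s b` at the old sites are those of `s`. [folklore] -/
private theorem spinVal_snoc_castSucc {n : ℕ} (s : Fin n → Bool) (b : Bool) (i : Fin n) :
    spinVal (Fin.snoc s b : Fin (n + 1) → Bool) i.castSucc = spinVal s i := by
  simp only [spinVal, Fin.snoc_castSucc]

/-- The last spin of `snoc s true` is `+1`. [folklore] -/
private theorem spinVal_snoc_last_true {n : ℕ} (s : Fin n → Bool) :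
    spinVal (Fin.snoc s true : Fin (n + 1) → Bool) (Fin.last n) = 1 := by
  simp [spinVal, Fin.snoc_last]

/-- The last spin of `snoc s false` is `-1`. [folklore] -/
private theorem spinVal_snoc_last_false {n : ℕ} (s : Fin n → Bool) :
    spinVal (Fin.snoc s false : Fin (n + 1) → Bool) (Fin.last n) = -1 := by
  simp [spinVal, Fin.snoc_last]

/-! ### The chain couplings -/

/-- Interior entries of the longer chain are those of the shorter one. [folklore] -/
private theorem chainJ_castSucc_castSucc (N : ℕ) (K : ℕ → ℝ) (i j : Fin (N + 1)) :
    chainJ (N + 1 + 1) K i.castSucc j.castSucc = chainJ (N + 1) K i j := rfl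

/-- Last column of the chain couplings: only the entry `(N, N + 1)` is nonzero. [folklore] -/
private theorem chainJ_castSucc_last (N : ℕ) (K : ℕ → ℝ) (i : Fin (N + 1)) :
    chainJ (N + 1 + 1) K i.castSucc (Fin.last (N + 1)) = if i = Fin.last N then K N / 2 else 0 := by
  have hi := i.is_lt
  unfold chainJ
  simp only [Fin.val_castSucc, Fin.val_last, Fin.ext_iff]
  split_ifs <;> first | rfl | omega | simp only [*]

/-- Last row of the chain couplings: only the entry `(N + 1, N)` is nonzero. [folklore] -/
private theorem chainJ_last_castSucc (N : ℕ) (K : ℕ → ℝ) (j : Fin (N + 1)) :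
    chainJ (N + 1 + 1) K (Fin.last (N + 1)) j.castSucc = if j = Fin.last N then K N / 2 else 0 := by
  have hj := j.is_lt
  unfold chainJ
  simp only [Fin.val_castSucc, Fin.val_last, Fin.ext_iff]
  split_ifs <;> first | rfl | omega | simp only [*]

/-- The corner entry `(N + 1, N + 1)` vanishes. [folklore] -/
private theorem chainJ_last_last (N : ℕ) (K : ℕ → ℝ) :
    chainJ (N + 1 + 1) K (Fin.last (N + 1)) (Fin.last (N + 1)) = 0 := by
  unfold chainJ
  simp only [Fin.val_last]
  split_ifs <;> first | rfl | omega

/-- A one-site chain has no bonds: its Boltzmann weights are `1`. [folklore] -/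
private theorem isingBoltzmann_base (K : ℕ → ℝ) (u : Fin (0 + 1) → Bool) :
    isingBoltzmann (chainJ (0 + 1) K) u = 1 := by
  have h : ∀ i j : Fin (0 + 1), chainJ (0 + 1) K i j = 0 := fun i j => by
    have hi := i.is_lt
    have hj := j.is_lt
    unfold chainJ
    split_ifs <;> first | rfl | omega
  simp [isingBoltzmann, isingPairEnergy, h]

/-! ### Splitting the energy and the magnetization -/

/-- `E_{N+1}(snoc s b) = E_N(s) + K_N σ_N(s) b`. [folklore] -/
private theorem isingPairEnergy_snoc (N : ℕ) (K : ℕ → ℝ) (s : Fin (N + 1) → Bool) (b : Bool) :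
    isingPairEnergy (chainJ (N + 1 + 1) K) (Fin.snoc s b : Fin (N + 1 + 1) → Bool) =
      isingPairEnergy (chainJ (N + 1) K) s + K N * spinVal s (Fin.last N) *
        spinVal (Fin.snoc s b : Fin (N + 1 + 1) → Bool) (Fin.last (N + 1)) := by
  simp only [isingPairEnergy, Fin.sum_univ_castSucc (n := N + 1), spinVal_snoc_castSucc,
    chainJ_castSucc_castSucc, chainJ_castSucc_last, chainJ_last_castSucc, chainJ_last_last,
    Finset.sum_add_distrib, ite_mul, zero_mul, Finset.sum_ite_eq', Finset.mem_univ, if_true,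
    add_zero]
  ring

/-- `M_{N+1}(snoc s b) = M_N(s) + w_{N+1} b`. [folklore] -/
private theorem weightedMagnetization_snoc (N : ℕ) (w : ℕ → ℝ) (s : Fin (N + 1) → Bool)
    (b : Bool) :
    weightedMagnetization (fun i : Fin (N + 1 + 1) => w i.val) (Fin.snoc s b : Fin (N + 1 + 1) → Bool) =
      weightedMagnetization (fun i : Fin (N + 1) => w i.val) s +
        w (N + 1) * spinVal (Fin.snoc s b : Fin (N + 1 + 1) → Bool) (Fin.last (N + 1)) := by
  simp only [weightedMagnetization, Fin.sum_univ_castSucc (n := N + 1), spinVal_snoc_castSucc,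
    Fin.val_castSucc, Fin.val_last]

/-- The magnetization of a one-site chain is `w₀ σ₀`. [folklore] -/
private theorem weightedMagnetization_base (w : ℕ → ℝ) (s : Fin 0 → Bool) (b : Bool) :
    weightedMagnetization (fun i : Fin (0 + 1) => w i.val) (Fin.snoc s b : Fin (0 + 1) → Bool) =
      w 0 * spinVal (Fin.snoc s b : Fin (0 + 1) → Bool) (Fin.last 0) := by
  simp [weightedMagnetization]

/-! ### The hyperbolic identity `e^{Kσ} = cosh K (1 + σ tanh K)` -/

/-- `e^{Kσ} = cosh K · (1 + tanh K · σ)` for a spin `σ = ±1`. [folklore] -/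
private theorem exp_mul_spinVal {n : ℕ} (K : ℝ) (s : Fin n → Bool) (i : Fin n) :
    Real.exp (K * spinVal s i) = Real.cosh K * (1 + Real.tanh K * spinVal s i) := by
  have hc : Real.cosh K ≠ 0 := (Real.cosh_pos K).ne'
  have key : Real.cosh K * (1 + Real.tanh K * spinVal s i) =
      Real.cosh K + Real.sinh K * spinVal s i := by
    rw [Real.tanh_eq_sinh_div_cosh]
    field_simp
  rw [key]
  unfold spinVal
  cases s i
  · rw [if_neg Bool.false_ne_true, mul_neg_one, mul_neg_one, ← sub_eq_add_neg, Real.cosh_sub_sinh]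
  · rw [if_pos rfl, mul_one, mul_one, Real.cosh_add_sinh]

/-- `e^{-Kσ} = cosh K · (1 - tanh K · σ)` for a spin `σ = ±1`. [folklore] -/
private theorem exp_neg_mul_spinVal {n : ℕ} (K : ℝ) (s : Fin n → Bool) (i : Fin n) :
    Real.exp (-(K * spinVal s i)) = Real.cosh K * (1 - Real.tanh K * spinVal s i) := by
  rw [← neg_mul, exp_mul_spinVal, Real.cosh_neg, Real.tanh_neg]
  ring

/-! ### One transfer step, configuration by configuration -/

/-- Summing the Gibbs–Laplace summand of the longer chain over the last spin:
`T(snoc s +) + T(snoc s −) = 2 cosh K_N (cosh x · T(s) + tanh K_N sinh x · T(s) σ_N(s))`,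
`x = z w_{N+1}`. [folklore] -/
private theorem step_fst (K w : ℕ → ℝ) (z : ℂ) (N : ℕ) (s : Fin (N + 1) → Bool) :
    (isingBoltzmann (chainJ (N + 1 + 1) K) (Fin.snoc s true : Fin (N + 1 + 1) → Bool) : ℂ) *
          Complex.exp (z * weightedMagnetization (fun i : Fin (N + 1 + 1) => w i.val)
            (Fin.snoc s true : Fin (N + 1 + 1) → Bool)) +
        (isingBoltzmann (chainJ (N + 1 + 1) K) (Fin.snoc s false : Fin (N + 1 + 1) → Bool) : ℂ) *
          Complex.exp (z * weightedMagnetization (fun i : Fin (N + 1 + 1) => w i.val)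
            (Fin.snoc s false : Fin (N + 1 + 1) → Bool)) =
      2 * (Real.cosh (K N) : ℂ) *
        (Complex.cosh (z * w (N + 1)) *
            ((isingBoltzmann (chainJ (N + 1) K) s : ℂ) *
              Complex.exp (z * weightedMagnetization (fun i : Fin (N + 1) => w i.val) s)) +
          (Real.tanh (K N) : ℂ) * Complex.sinh (z * w (N + 1)) *
            ((isingBoltzmann (chainJ (N + 1) K) s : ℂ) *
                Complex.exp (z * weightedMagnetization (fun i : Fin (N + 1) => w i.val) s) *
              spinVal s (Fin.last N))) := by
  simp only [isingBoltzmann, isingPairEnergy_snoc, weightedMagnetization_snoc,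
    spinVal_snoc_last_true, spinVal_snoc_last_false, mul_one, Real.exp_add, Complex.ofReal_mul,
    Complex.ofReal_add, Complex.ofReal_neg, mul_add, mul_neg, Complex.exp_add]
  rw [exp_mul_spinVal, exp_neg_mul_spinVal, Complex.cosh, Complex.sinh]
  push_cast
  ring

/-- The same sum weighted by the last spin:
`T(snoc s +) − T(snoc s −) = 2 cosh K_N (sinh x · T(s) + tanh K_N cosh x · T(s) σ_N(s))`. [folklore] -/
private theorem step_snd (K w : ℕ → ℝ) (z : ℂ) (N : ℕ) (s : Fin (N + 1) → Bool) :
    (isingBoltzmann (chainJ (N + 1 + 1) K) (Fin.snoc s true : Fin (N + 1 + 1) → Bool) : ℂ) *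
            Complex.exp (z * weightedMagnetization (fun i : Fin (N + 1 + 1) => w i.val)
              (Fin.snoc s true : Fin (N + 1 + 1) → Bool)) *
          spinVal (Fin.snoc s true : Fin (N + 1 + 1) → Bool) (Fin.last (N + 1)) +
        (isingBoltzmann (chainJ (N + 1 + 1) K) (Fin.snoc s false : Fin (N + 1 + 1) → Bool) : ℂ) *
            Complex.exp (z * weightedMagnetization (fun i : Fin (N + 1 + 1) => w i.val)
              (Fin.snoc s false : Fin (N + 1 + 1) → Bool)) *
          spinVal (Fin.snoc s false : Fin (N + 1 + 1) → Bool) (Fin.last (N + 1)) =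
      2 * (Real.cosh (K N) : ℂ) *
        (Complex.sinh (z * w (N + 1)) *
            ((isingBoltzmann (chainJ (N + 1) K) s : ℂ) *
              Complex.exp (z * weightedMagnetization (fun i : Fin (N + 1) => w i.val) s)) +
          (Real.tanh (K N) : ℂ) * Complex.cosh (z * w (N + 1)) *
            ((isingBoltzmann (chainJ (N + 1) K) s : ℂ) *
                Complex.exp (z * weightedMagnetization (fun i : Fin (N + 1) => w i.val) s) *
              spinVal s (Fin.last N))) := by
  simp only [isingBoltzmann, isingPairEnergy_snoc, weightedMagnetization_snoc,
    spinVal_snoc_last_true, spinVal_snoc_last_false, mul_one, Real.exp_add, Complex.ofReal_mul,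
    Complex.ofReal_add, Complex.ofReal_neg, Complex.ofReal_one, mul_add, mul_neg, Complex.exp_add]
  rw [exp_mul_spinVal, exp_neg_mul_spinVal, Complex.cosh, Complex.sinh]
  push_cast
  ring

/-! ### The transfer recursion -/

/-- **Transfer recursion for open chains** (both components): with `T_s = B_s e^{z M_s}` over the
configurations of the chain on `Fin (N + 1)`,
`(Σ_s T_s, Σ_s T_s σ_N(s)) = (∏_{m<N} 2 cosh K_m) · sdIter z w (tanh ∘ K) N`. [folklore] -/
theorem chain_partition_pair (K w : ℕ → ℝ) (z : ℂ) (N : ℕ) :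
    (∑ s : Fin (N + 1) → Bool, (isingBoltzmann (chainJ (N + 1) K) s : ℂ) *
          Complex.exp (z * weightedMagnetization (fun i : Fin (N + 1) => w i.val) s)) =
        ((∏ m ∈ Finset.range N, 2 * Real.cosh (K m) : ℝ) : ℂ) *
          (sdIter z w (fun m => Real.tanh (K m)) N).1 ∧
      (∑ s : Fin (N + 1) → Bool, (isingBoltzmann (chainJ (N + 1) K) s : ℂ) *
            Complex.exp (z * weightedMagnetization (fun i : Fin (N + 1) => w i.val) s) *
          spinVal s (Fin.last N)) =
        ((∏ m ∈ Finset.range N, 2 * Real.cosh (K m) : ℝ) : ℂ) *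
          (sdIter z w (fun m => Real.tanh (K m)) N).2 := by
  induction N with
  | zero =>
    simp only [sum_config_snoc 0, isingBoltzmann_base, weightedMagnetization_base,
      spinVal_snoc_last_true, spinVal_snoc_last_false, Fintype.sum_unique, Finset.prod_range_zero,
      sdIter, mul_one, Complex.ofReal_one, one_mul, Complex.ofReal_neg, mul_neg]
    rw [Complex.cosh, Complex.sinh]
    constructor <;> ring
  | succ N ih =>
    obtain ⟨ih1, ih2⟩ := ih
    simp only [sum_config_snoc (N + 1), step_fst K w z N, step_snd K w z N, ← Finset.mul_sum,
      Finset.sum_add_distrib]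
    rw [ih1, ih2, Finset.prod_range_succ]
    simp only [sdIter, sdStep]
    push_cast
    constructor <;> ring

/-- At `z = 0` the transfer recursion is constant: `sdIter 0 w c N = (2, 0)`. [folklore] -/
theorem sdIter_zero (w c : ℕ → ℝ) (N : ℕ) : sdIter 0 w c N = (2, 0) := by
  induction N with
  | zero => simp [sdIter]
  | succ N ih => simp [sdIter, sdStep, ih]

/-- **Transfer-matrix identity for open chains** (stub `stub_transfer` of the line
`telegraph-bessel-chain`): the Laplace transform at `z` of the magnetization law of the open chain
on the sites `0, …, N` (weights `w m`, bond `m` coupling `K m`) is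
`(sdIter z w (tanh ∘ K) N).1 / 2`. [folklore] -/
theorem stub_transfer (N : ℕ) (K w : ℕ → ℝ) (z : ℂ) :
    ∫ u, Complex.exp (z * u)
        ∂(isingMagnetizationLaw (N + 1) (chainJ (N + 1) K) (fun i => w i.val) : Measure ℝ) =
      (sdIter z w (fun m => Real.tanh (K m)) N).1 / 2 := by
  have hP : ((∏ m ∈ Finset.range N, 2 * Real.cosh (K m) : ℝ) : ℂ) ≠ 0 :=
    Complex.ofReal_ne_zero.2
      (Finset.prod_pos fun m _ => mul_pos two_pos (Real.cosh_pos (K m))).ne'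
  have h0 := (chain_partition_pair K w 0 N).1
  rw [sdIter_zero] at h0
  rw [integral_exp_isingMagnetizationLaw,
    ← isingFieldPartition_zero (chainJ (N + 1) K) (fun i => w i.val)]
  simp only [isingFieldPartition]
  rw [(chain_partition_pair K w z N).1, h0, mul_div_mul_left _ _ hP]

end Summit.RiemannHypothesis.RiemannHypothesis.Theorems.LeeYangTelegraph

end
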